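import Literature.NumberTheory.Automorphic.LocalConstantsProofs    -- ★ `unitsComplex_noSmallSubgroups` (`ℂˣ` has no small subgroups)
import HarnessLib

/-!
# F0 · P3c · line LH6 «StCharTS» — road (D) «DEEP-FL», (D-c) glue «CHARACTER TRIVIAL NEAR 1»: a character of a non-archimedean group, continuous at `1`, is trivial on an
# open subgroup; relative version for a character of a subgroup — the `∃ U ∈ 𝓝 1` device of the XIG-St head ((R5): `χ_ξ` trivial on `T ∩ U`)

Cell `pub/hodgecm-mathlib`, crux H413 = `stmt-HodgeConjecture-24833` (lane `--supports … --as helper`), route HCCMUnconditional; seat LH6-p04 (g3) = road (D) owner of record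
(spec ROAD-D v7 `F0/P3b/LH6-p04/g3/ROAD-D.status.v7.txt`, § «∃ U ∈ 𝓝 1 (owner, head)»).  THEOREMS ONLY, sorry-free, generic; no definition ∕ instance ∕ notation ∕ named fact.
HONEST LABEL: HC_CM is proved only modulo the 7 printed citations (2 remaining: hLiu418 = stmt-HodgeConjecture-24832, h413 = stmt-HodgeConjecture-24833) until rung 0 closes;
count-neutral plumbing.

THE MATHEMATICS ([TateThesis1967, §2.3]; [Rogawski1990, §12.7 L. 12.7.3 (proof) p. 195 «for `K_n` small enough»]).  `ℂˣ` has no small subgroups (★ `unitsComplex_noSmallSubgroups`: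
an open `N ∋ 1` containing no non-trivial subgroup); a non-archimedean group has a basis of open subgroups at `1`; so for `χ : G →* ℂˣ` continuous at `1` the open set `χ⁻¹(N)` contains an
open subgroup `V`, `χ(V)` is a subgroup inside `N`, hence `χ|_V = 1`.  For a character `χ` of a SUBGROUP `M ≤ G` (subspace topology; e.g. the torus `T ≤ U(Φ₃)_v` and `χ_ξ`) the same
gives `U ∈ 𝓝 (1 : G)` with `χ t = 1` for every `t ∈ M` with `↑t ∈ U`.

* `exists_openSubgroup_forall_apply_eq_one`, `exists_nhds_forall_apply_eq_one`, **`exists_nhds_forall_subtype_apply_eq_one`**, `exists_nhds_forall_subtype_apply_eq_one₂` (two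
  characters at once), `inter_mem_nhds_one₃` (bookkeeping: three neighbourhoods of `1` intersect in one).

## References
* [TateThesis1967] J. Tate, *Fourier analysis in number fields and Hecke's zeta-functions*, in Cassels–Fröhlich (1967), §2.3.
* [Rogawski1990] J. D. Rogawski, *Automorphic Representations of Unitary Groups in Three Variables*, Ann. of Math. Stud. 123 (1990), §12.7 Lemma 12.7.3 (proof) p. 195.
-/

set_option autoImplicit false
-- the mandated namespace has the single-problem summit's repeated segment (`HodgeConjecture.HodgeConjecture`)
set_option linter.dupNamespace false

open Topology Filter

namespace Summit.HodgeConjecture.HodgeConjecture.Cruxes.H413.F0P3cStCharTSCharTrivialNhds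

variable {G : Type*} [Group G] [TopologicalSpace G] [NonarchimedeanGroup G]

/-- **A character `χ : G →* ℂˣ` of a non-archimedean group, continuous at `1`, is trivial on an open subgroup.** [cite: TateThesis1967, §2.3] -/
theorem exists_openSubgroup_forall_apply_eq_one (χ : G →* ℂˣ) (hχ : ContinuousAt χ 1) :
    ∃ V : OpenSubgroup G, ∀ g ∈ V, χ g = 1 := by
  obtain ⟨N, hNo, hN1, hN⟩ := Literature.NumberTheory.Automorphic.unitsComplex_noSmallSubgroups
  have hpre : (χ : G → ℂˣ) ⁻¹' N ∈ 𝓝 (1 : G) := by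
    refine hχ.preimage_mem_nhds ?_
    rw [map_one]
    exact hNo.mem_nhds hN1
  obtain ⟨V, hV⟩ := NonarchimedeanGroup.is_nonarchimedean _ hpre
  refine ⟨V, fun g hg => hN (χ g) fun n => ?_⟩
  rw [← map_pow]
  exact hV (V.pow_mem hg n)

/-- Neighbourhood form: `∃ U ∈ 𝓝 1, ∀ g ∈ U, χ g = 1`. [cite: TateThesis1967, §2.3] -/
theorem exists_nhds_forall_apply_eq_one (χ : G →* ℂˣ) (hχ : ContinuousAt χ 1) :
    ∃ U ∈ 𝓝 (1 : G), ∀ g ∈ U, χ g = 1 := by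
  obtain ⟨V, hV⟩ := exists_openSubgroup_forall_apply_eq_one χ hχ
  exact ⟨V, V.mem_nhds_one, hV⟩

omit [NonarchimedeanGroup G] in
/-- **Relative form for a character of a subgroup `M ≤ G`** (subspace topology; `M` itself non-archimedean, e.g. closed in a non-archimedean `G`): if `χ : M →* ℂˣ` is continuous
at `1` then `∃ U ∈ 𝓝 (1 : G)`, `χ t = 1` for all `t ∈ M` with `↑t ∈ U` — the shape of the XIG head's choice of `U` ((R5) `χ_ξ|_{T ∩ U} = 1`).
[cite: Rogawski1990, §12.7 Lemma 12.7.3 (proof) p. 195] [cite: TateThesis1967, §2.3] -/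
theorem exists_nhds_forall_subtype_apply_eq_one (M : Subgroup G) [NonarchimedeanGroup M] (χ : M →* ℂˣ) (hχ : ContinuousAt χ 1) :
    ∃ U ∈ 𝓝 (1 : G), ∀ t : M, (t : G) ∈ U → χ t = 1 := by
  obtain ⟨W, hW, hWχ⟩ := exists_nhds_forall_apply_eq_one χ hχ
  obtain ⟨U, hU, hUW⟩ := (mem_nhds_subtype _ (1 : M) W).1 hW
  exact ⟨U, hU, fun t ht => hWχ t (hUW ht)⟩

omit [NonarchimedeanGroup G] in
/-- Two characters of `M` at once: one `U ∈ 𝓝 (1 : G)` on which both are trivial along `M`. [cite: TateThesis1967, §2.3] -/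
theorem exists_nhds_forall_subtype_apply_eq_one₂ (M : Subgroup G) [NonarchimedeanGroup M] (χ χ' : M →* ℂˣ) (hχ : ContinuousAt χ 1) (hχ' : ContinuousAt χ' 1) :
    ∃ U ∈ 𝓝 (1 : G), ∀ t : M, (t : G) ∈ U → χ t = 1 ∧ χ' t = 1 := by
  obtain ⟨U, hU, h⟩ := exists_nhds_forall_subtype_apply_eq_one M χ hχ
  obtain ⟨U', hU', h'⟩ := exists_nhds_forall_subtype_apply_eq_one M χ' hχ'
  exact ⟨U ∩ U', inter_mem hU hU', fun t ht => ⟨h t ht.1, h' t ht.2⟩⟩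

omit [NonarchimedeanGroup G] [Group G] in
/-- Bookkeeping for the head's `U := U₁ ∩ U₂ ∩ U₃`: three neighbourhoods of a point intersect in one, with the three inclusions. [cite: Rogawski1990, §12.7 Lemma 12.7.3 (proof) p. 195] -/
theorem inter_mem_nhds_one₃ {x : G} {U₁ U₂ U₃ : Set G} (h₁ : U₁ ∈ 𝓝 x) (h₂ : U₂ ∈ 𝓝 x) (h₃ : U₃ ∈ 𝓝 x) :
    ∃ U ∈ 𝓝 x, U ⊆ U₁ ∧ U ⊆ U₂ ∧ U ⊆ U₃ :=
  ⟨U₁ ∩ U₂ ∩ U₃, inter_mem (inter_mem h₁ h₂) h₃, fun _ h => h.1.1, fun _ h => h.1.2, fun _ h => h.2⟩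

end Summit.HodgeConjecture.HodgeConjecture.Cruxes.H413.F0P3cStCharTSCharTrivialNhds
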